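import Literature.NumberTheory.LFunctions.LiouvilleCertificate

/-!
# Certified Haselgrove computation: the bracket range, `1/ζ(½)`, and the final sums

Compiled evaluation (`native_decide`) of `Literature.NumberTheory.LFunctions.ZetaNumerics.Liouville.checkFinal`:
the bracket range `t₂(648) ≤ 1000 ≤ t₁(649)` (exactly the first 649 certified zeros lie below
Haselgrove's height `m = 1000`), a certified enclosure of `Re (1/ζ(½)) = -0.6847…` (one
Euler–Maclaurin evaluation at `s = ½`), and the comparisons `1/ζ(½) + Σ L_k 2^{-60} > 0`,
`-1/ζ(½) + Σ U_k 2^{-60} < 0` (`final_of_checkFinal`). The only non-standard axiom of this file is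
the `native_decide` auxiliary axiom (trust in the Lean compiler), declared to the gate as
`computational`.
-/

namespace Literature.NumberTheory.LFunctions.LiouvilleCertificate.ZetaNumerics.Liouville

/-- The final check passes: `checkFinal = true`. [cite: BorweinFergusonMossinghoff2008, §1 pp. 1683–1684] -/
theorem checkFinal_holds : ZetaNumerics.Liouville.checkFinal = true := by
  native_decide

end Literature.NumberTheory.LFunctions.LiouvilleCertificate.ZetaNumerics.Liouville
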